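import Mathlib
import Summits.NavierStokesRegularity.NavierStokesRegularity.Theorems.EulerZoomLiouvillePowerGaugeEulerLiouvilleNeedleStrainClock
import Summits.NavierStokesRegularity.NavierStokesRegularity.Theorems.EulerZoomLiouvillePowerGaugeEulerLiouvilleNeedleClockThresholdMember
import Summits.NavierStokesRegularity.NavierStokesRegularity.Theorems.EulerZoomLiouvillePowerGaugeEulerLiouvilleSelfSimilarPastStrata
import Summits.NavierStokesRegularity.NavierStokesRegularity.Theorems.EulerZoomLiouvillePowerGaugeEulerLiouvilleSelfSimilarBernoulliSqueezeFreeCrossing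
import Literature.Analysis.FluidPDE.TaoEnstrophyLocalisation
import HarnessLib.Audit

/-!
# Crux E `EulerZoomLiouville.PowerGaugeEulerLiouville` — THE ENVELOPE-FREE STRAIN CLOCK (plate t40d, bonus M2 of ROUND-40):
# stretching rate below `(1+2ρ)/(2(2+ρ))` alone makes a `C²` class profile trivial

Route №10 `EulerZoomLiouville` (NavierStokesRegularity), crux E = stmt-NavierStokesRegularity-19832, registered residue
`stub_selfSimilarC2Needle` (THE ONE STATEMENT, LEAD ns-typeII-p2 g12, skeleton v68); memo ROUND-40 of the cell
`ns-regularity-ideate` (nsreg-p2 g33); seat ns-ezl-w5 g3, `--supports stmt-NavierStokesRegularity-19832 --as helper`.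

The member theorem `NeedleRace.selfSimilar_ae_eq_zero_of_strainClockC2` (…NeedleStrainClockMember) needs, besides the
subcritical stretching `s < 1`, a pointwise sub-power VORTICITY ENVELOPE.  Here the envelope is REPLACED by the class's own
enstrophy budget `∫_{B̄_L}‖DV‖² ≤ C_E L^{1−ρ}` (E-gauge) at the price of a stronger stretching threshold:

* `NeedleClock.volume_linger_set_le_of_stretching` (profile level, the LIOUVILLE–CHEBYSHEV RACE): `(V, P′)` a classical
  self-similar Euler profile at rate `γ = 1/(2+ρ)`, stretching `⟪DV(z) v, v⟫ ≤ s‖v‖²` everywhere, enstrophy budget as above,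
  `‖curl V‖ > ω` on a measurable set `D` every label of which lingers in `‖·‖ ≤ M` during `[0, t]` (`1 ≤ M`, `0 ≤ t`) under a
  cut-off copy `V′`: then `ω² e^{2(1−s)t} · vol D ≤ e^{3γt} · ‖curlCLM‖² · C_E M^{1−ρ}` — the stretching clock
  (`norm_curl_mul_exp_le_curl_flow_of_stretching_linger`: `‖Ω(Ψ_t y)‖ ≥ e^{(1−s)t}‖Ω(y)‖`) integrated over `D` with the local
  Liouville law in the change-of-variables form `∫_D g(Ψ_t y) dy = e^{3γt} ∫_{Ψ_t(D)} g` (`Loc.lintegral_comp_backwardFlow_eq_of_stay`)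
  and `Ψ_t(D) ⊆ B̄_M`, `‖curl V‖ ≤ ‖curlCLM‖·‖DV‖`;
* `NeedleClock.powerClock_of_stretching_lt` — if `3γ < 2(1−s)`, i.e. `s < (1+2ρ)/(2(2+ρ))`, the race is won at every power
  window `t = c′R^{2+ρ}`: p645025's `hclock` VERBATIM (volume of the lingering part of a small vortical ball `→ 0`
  super-exponentially, in particular `≤` half the ball for large `R`);
* **`NeedleRace.selfSimilar_ae_eq_zero_of_strongStrainClockC2`** (member level) — crux hypotheses verbatim (`0 < ρ ≤ ½`) +
  exact self-similarity about the origin with a `C²` profile + `⟪DV(z) v, v⟫ ≤ s‖v‖²` for all `z, v` with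
  `s < (1+2ρ)/(2(2+ρ))` ⇒ `u = 0` a.e.  NO envelope, NO growth, NO pressure clause.

Numerics: the threshold `(1+2ρ)/(2(2+ρ))` is `2/5` at `ρ = ½` and `→ 1/4` as `ρ → 0`; the radial needle portrait forces
`λ_max(sym DV) ≥ γ/2 = 1/(2(2+ρ))` at far vortical fast-inflow points (trace zero), strictly below the threshold, so the stratum
is not vacuous against the portrait.  NOT NS, not E: a conditional stratum of the crux CLASS (MODEL lattice); 19832 OPEN.
References: Constantin–Ignatova–Vicol arXiv:2602.17570 §3.4–§3.5 [ConstantinIgnatovaVicol2026Putative]; Liouville's formula,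
Chebyshev [folklore].
-/

noncomputable section

-- the summit and its single problem share the name `NavierStokesRegularity` (D-0017 nested layout)
set_option linter.dupNamespace false

open Set Filter Topology Metric Function MeasureTheory InnerProductSpace
open scoped RealInnerProductSpace NNReal ENNReal

namespace Summit.NavierStokesRegularity.NavierStokesRegularity.Theorems.PowerGaugeEulerLiouville

open Literature.Analysis Literature.Analysis.FluidPDE

/-! ## Profile level: the Liouville–Chebyshev race -/

namespace NeedleClock

variable {ρ : ℝ} {V V' : EuclideanSpace ℝ (Fin 3) → EuclideanSpace ℝ (Fin 3)} {P' : EuclideanSpace ℝ (Fin 3) → ℝ}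

/-- **THE LIOUVILLE–CHEBYSHEV RACE for lingering sets under a stretching bound.**  `(V, P′)` a classical self-similar
Euler profile at rate `γ = 1/(2+ρ)`; stretching `⟪DV(z) v, v⟫ ≤ s‖v‖²` everywhere; enstrophy budget
`∫⁻_{B̄_L}‖DV‖² ≤ C_E L^{1−ρ}` (`L ≥ 1`); `V′` a `C²` cut-off copy (`‖DV′‖ ≤ K`, `V′ = V` on `ball 0 R_big`, `M < R_big`,
`1 ≤ M`); `D` a measurable set with `ω < ‖curl V‖` on `D` (`0 ≤ ω`) all of whose labels linger in `‖·‖ ≤ M` during `[0, t]`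
(`0 ≤ t`) under the backward cut-off similarity flow.  Then
`ω² e^{2(1−s)t} · vol D ≤ e^{3t/(2+ρ)} · ‖curlCLM‖² · C_E · M^{1−ρ}`.
[cite: ConstantinIgnatovaVicol2026Putative, §3.4.1 eq. (3.22)–(3.24)] -/
theorem volume_linger_set_le_of_stretching (hprof : IsSelfSimilarEulerProfile (1 / (2 + ρ)) 0 V P')
    {s : ℝ} (hstrain : ∀ z v : EuclideanSpace ℝ (Fin 3), ⟪fderiv ℝ V z v, v⟫ ≤ s * ‖v‖ ^ 2)
    {CE : ℝ}
    (hbE : ∀ L : ℝ, 1 ≤ L → ∫⁻ z in closedBall (0 : EuclideanSpace ℝ (Fin 3)) L, ‖fderiv ℝ V z‖ₑ ^ 2 ≤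
      ENNReal.ofReal (CE * L ^ (1 - ρ)))
    (hV' : ContDiff ℝ 2 V') {K : ℝ} (hK : ∀ y, ‖fderiv ℝ V' y‖ ≤ K) {M Rbig : ℝ} (hM1 : 1 ≤ M) (hMR : M < Rbig)
    (hVU : ∀ w ∈ ball (0 : EuclideanSpace ℝ (Fin 3)) Rbig, V' w = V w)
    {D : Set (EuclideanSpace ℝ (Fin 3))} (hDm : MeasurableSet D) {ω : ℝ} (hω : 0 ≤ ω)
    (hDω : ∀ y ∈ D, ω < ‖curl V y‖) {t : ℝ} (ht : 0 ≤ t)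
    (hstay : ∀ y ∈ D, ∀ σ ∈ Icc 0 t,
      ‖ODE.evolutionMap (fun _ : ℝ => selfSimilarTransport (1 / (2 + ρ)) 0 V') 0 (-σ) y‖ ≤ M) :
    ENNReal.ofReal (ω ^ 2 * Real.exp (2 * (1 - s) * t)) * volume D ≤
      ENNReal.ofReal (Real.exp (3 * (1 / (2 + ρ)) * t) *
        (‖(curlCLM : (EuclideanSpace ℝ (Fin 3) →L[ℝ] EuclideanSpace ℝ (Fin 3)) →L[ℝ] EuclideanSpace ℝ (Fin 3))‖ ^ 2 *
          (CE * M ^ (1 - ρ)))) := by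
  set γ : ℝ := 1 / (2 + ρ) with hγ
  set Φ := ODE.evolutionMap (fun _ : ℝ => selfSimilarTransport γ 0 V') 0 with hΦ
  set cC : ℝ := ‖(curlCLM : (EuclideanSpace ℝ (Fin 3) →L[ℝ] EuclideanSpace ℝ (Fin 3)) →L[ℝ]
    EuclideanSpace ℝ (Fin 3))‖ with hcC
  have hV'1 : ContDiff ℝ 1 V' := hV'.of_le (by norm_num)
  -- the cut-off is divergence free on `B̄_M`
  have hdiv : ∀ z : EuclideanSpace ℝ (Fin 3), ‖z‖ ≤ M → VectorCalculus.divergence V' z = 0 := by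
    intro z hz
    have hzb : z ∈ ball (0 : EuclideanSpace ℝ (Fin 3)) Rbig := mem_ball_zero_iff.2 (lt_of_le_of_lt hz hMR)
    have hfd : fderiv ℝ V' z = fderiv ℝ V z := fderiv_eq_of_agree_ball hVU hzb
    have h := hprof.divFree z
    simp only [VectorCalculus.divergence] at h ⊢
    rw [hfd]; exact h
  -- (1) lower bound of the transported integrand on `D`: `(ω e^{(1−s)t})² ≤ ‖curl V (Ψ_t y)‖²`
  have hlow : ∀ y ∈ D, ENNReal.ofReal (ω ^ 2 * Real.exp (2 * (1 - s) * t)) ≤ ‖curl V (Φ (-t) y)‖ₑ ^ 2 := by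
    intro y hy
    have h1 := norm_curl_mul_exp_le_curl_flow_of_stretching_linger (γ := γ) (U := V) (V := V') hprof hV' hK hMR hVU
      (fun z _ v => hstrain z v) (hstay y hy) (right_mem_Icc.2 ht)
    have h2 : ω * Real.exp ((1 - s) * t) ≤ ‖curl V (Φ (-t) y)‖ :=
      le_trans (mul_le_mul_of_nonneg_right (hDω y hy).le (Real.exp_pos _).le) h1
    have h3 : ω ^ 2 * Real.exp (2 * (1 - s) * t) = (ω * Real.exp ((1 - s) * t)) ^ 2 := by
      rw [mul_pow, ← Real.exp_nat_mul]; ring_nf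
    rw [h3, ← ofReal_norm, ← ENNReal.ofReal_pow (norm_nonneg _)]
    exact ENNReal.ofReal_le_ofReal (pow_le_pow_left₀ (by positivity) h2 2)
  -- (2) Liouville change of variables
  have hcov := Loc.lintegral_comp_backwardFlow_eq_of_stay (γ := γ) hV' hK ht hdiv hDm hstay
    (fun z => ‖curl V z‖ₑ ^ 2)
  -- (3) the image lies in `B̄_M`
  have hsub : Φ t ⁻¹' D ⊆ closedBall (0 : EuclideanSpace ℝ (Fin 3)) M := by
    intro z hz
    have hy : Φ t z ∈ D := hz
    have hback : Φ (-t) (Φ t z) = z := by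
      have h1 := C2.Kelvin.flow_add (γ := γ) hV'1 hK (-t) t z
      rw [neg_add_cancel] at h1
      rw [← hΦ] at h1
      rw [← h1]; exact ODE.evolutionMap_self _ 0 z
    have h := hstay _ hy t (right_mem_Icc.2 ht)
    rw [hback] at h
    exact mem_closedBall_zero_iff.2 h
  -- (4) enstrophy on `B̄_M` controls the vorticity there
  have hcurl_int : ∫⁻ z in Φ t ⁻¹' D, ‖curl V z‖ₑ ^ 2 ≤ ENNReal.ofReal (cC ^ 2 * (CE * M ^ (1 - ρ))) := by
    calc ∫⁻ z in Φ t ⁻¹' D, ‖curl V z‖ₑ ^ 2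
        ≤ ∫⁻ z in closedBall (0 : EuclideanSpace ℝ (Fin 3)) M, ‖curl V z‖ₑ ^ 2 := lintegral_mono_set hsub
      _ ≤ ∫⁻ z in closedBall (0 : EuclideanSpace ℝ (Fin 3)) M, ENNReal.ofReal (cC ^ 2) * ‖fderiv ℝ V z‖ₑ ^ 2 := by
          refine lintegral_mono fun z => ?_
          rw [← ofReal_norm, ← ofReal_norm, ← ENNReal.ofReal_pow (norm_nonneg _),
            ← ENNReal.ofReal_pow (norm_nonneg _), ← ENNReal.ofReal_mul (sq_nonneg _), ← mul_pow]
          exact ENNReal.ofReal_le_ofReal (pow_le_pow_left₀ (norm_nonneg _) (norm_curl_le V z) 2)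
      _ = ENNReal.ofReal (cC ^ 2) * ∫⁻ z in closedBall (0 : EuclideanSpace ℝ (Fin 3)) M, ‖fderiv ℝ V z‖ₑ ^ 2 :=
          lintegral_const_mul' _ _ ENNReal.ofReal_ne_top
      _ ≤ ENNReal.ofReal (cC ^ 2) * ENNReal.ofReal (CE * M ^ (1 - ρ)) := by gcongr; exact hbE M hM1
      _ = ENNReal.ofReal (cC ^ 2 * (CE * M ^ (1 - ρ))) := (ENNReal.ofReal_mul (sq_nonneg _)).symm
  -- assemble
  calc ENNReal.ofReal (ω ^ 2 * Real.exp (2 * (1 - s) * t)) * volume D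
      = ∫⁻ _ in D, ENNReal.ofReal (ω ^ 2 * Real.exp (2 * (1 - s) * t)) := (setLIntegral_const _ _).symm
    _ ≤ ∫⁻ y in D, ‖curl V (Φ (-t) y)‖ₑ ^ 2 := setLIntegral_mono' hDm fun y hy => hlow y hy
    _ = ENNReal.ofReal (Real.exp (3 * γ * t)) * ∫⁻ z in Φ t ⁻¹' D, ‖curl V z‖ₑ ^ 2 := hcov
    _ ≤ ENNReal.ofReal (Real.exp (3 * γ * t)) * ENNReal.ofReal (cC ^ 2 * (CE * M ^ (1 - ρ))) := by
        gcongr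
    _ = ENNReal.ofReal (Real.exp (3 * γ * t) * (cC ^ 2 * (CE * M ^ (1 - ρ)))) :=
        (ENNReal.ofReal_mul (Real.exp_pos _).le).symm

/-- **THE ENVELOPE-FREE POWER CLOCK**: if the stretching rate beats the Liouville rate, `3/(2+ρ) < 2(1−s)` (equivalently
`s < (1+2ρ)/(2(2+ρ))`), a classical self-similar Euler profile (`ρ ≥ 0`) with `⟪DV(z) v, v⟫ ≤ s‖v‖²` everywhere and
the class enstrophy budget `∫⁻_{B̄_L}‖DV‖² ≤ C_E L^{1−ρ}` carries the POWER residence clock of the skeleton for EVERY `c′ > 0`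
(p645025's `hclock` VERBATIM). [cite: ConstantinIgnatovaVicol2026Putative, §3.5] -/
theorem powerClock_of_stretching_lt (hprof : IsSelfSimilarEulerProfile (1 / (2 + ρ)) 0 V P') (hρ0 : 0 ≤ ρ)
    {s : ℝ} (hs : 3 / (2 + ρ) < 2 * (1 - s))
    (hstrain : ∀ z v : EuclideanSpace ℝ (Fin 3), ⟪fderiv ℝ V z v, v⟫ ≤ s * ‖v‖ ^ 2)
    {CE : ℝ} (hCE : 0 ≤ CE)
    (hbE : ∀ L : ℝ, 1 ≤ L → ∫⁻ z in closedBall (0 : EuclideanSpace ℝ (Fin 3)) L, ‖fderiv ℝ V z‖ₑ ^ 2 ≤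
      ENNReal.ofReal (CE * L ^ (1 - ρ))) :
    ∀ c' : ℝ, 0 < c' → ∀ x₀ : EuclideanSpace ℝ (Fin 3), curl V x₀ ≠ 0 → ∃ r : ℝ, 0 < r ∧ ∃ R₀ : ℝ,
      ∀ R : ℝ, R₀ ≤ R → ∀ (V' : EuclideanSpace ℝ (Fin 3) → EuclideanSpace ℝ (Fin 3)) (K Rbig : ℝ), ContDiff ℝ 2 V' →
        (∀ y, ‖fderiv ℝ V' y‖ ≤ K) → 2 * R < Rbig →
        (∀ w ∈ ball (0 : EuclideanSpace ℝ (Fin 3)) Rbig, V' w = V w) →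
        (volume (ball x₀ r ∩ {y | ∀ σ ∈ Icc 0 (c' * R ^ (2 + ρ)),
          ‖ODE.evolutionMap (fun _ : ℝ => selfSimilarTransport (1 / (2 + ρ)) 0 V') 0 (-σ) y‖ ≤ 2 * R})).toReal ≤
          (volume (ball x₀ r)).toReal / 2 := by
  intro c' hc' x₀ hx₀
  have h2ρ : (0 : ℝ) < 2 + ρ := by linarith
  set γ : ℝ := 1 / (2 + ρ) with hγ
  have hγpos : 0 < γ := one_div_pos.2 h2ρ
  set cC : ℝ := ‖(curlCLM : (EuclideanSpace ℝ (Fin 3) →L[ℝ] EuclideanSpace ℝ (Fin 3)) →L[ℝ]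
    EuclideanSpace ℝ (Fin 3))‖ with hcC
  have hU2 : ContDiff ℝ 2 V := hprof.contDiff_velocity
  have hcurlc : Continuous (curl V) := (differentiable_curl_of_contDiff hU2).continuous
  -- a ball around `x₀` on which `‖curl V‖ > ω := ‖curl V x₀‖ / 2`
  set ω : ℝ := ‖curl V x₀‖ / 2 with hωdef
  have hωpos : 0 < ω := by rw [hωdef]; exact half_pos (norm_pos_iff.2 hx₀)
  have hopen : IsOpen {y : EuclideanSpace ℝ (Fin 3) | ω < ‖curl V y‖} := isOpen_lt continuous_const hcurlc.norm
  have hx₀mem : x₀ ∈ {y : EuclideanSpace ℝ (Fin 3) | ω < ‖curl V y‖} := by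
    show ω < ‖curl V x₀‖
    rw [hωdef]; linarith [norm_pos_iff.2 hx₀]
  obtain ⟨r, hr, hball⟩ := Metric.isOpen_iff.1 hopen x₀ hx₀mem
  -- the volume of the ball
  set v : ℝ := (volume (ball x₀ r)).toReal with hv
  have hvpos : 0 < v := ENNReal.toReal_pos (measure_ball_pos volume x₀ hr).ne' measure_ball_lt_top.ne
  -- the race margin `δ := 2(1−s) − 3γ > 0` and the threshold radius
  set δ : ℝ := 2 * (1 - s) - 3 * γ with hδ
  have hδpos : 0 < δ := by
    have h3 : 3 * (1 / (2 + ρ)) = 3 / (2 + ρ) := by ring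
    rw [hδ, hγ, h3]; linarith
  set A : ℝ := cC ^ 2 * CE * 2 / ω ^ 2 with hA
  have hA0 : 0 ≤ A := by rw [hA]; positivity
  set R₀ : ℝ := max 1 (4 * A / (δ * c' * v) + 1) with hR₀
  refine ⟨r, hr, R₀, fun R hR V' K Rbig hV' hK hRbig hVU => ?_⟩
  have hR1 : 1 ≤ R := le_trans (le_max_left _ _) hR
  have hR0 : 0 < R := by linarith
  have hRA : 4 * A / (δ * c' * v) < R :=
    lt_of_lt_of_le (by linarith [le_max_right 1 (4 * A / (δ * c' * v) + 1)]) hR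
  set t : ℝ := c' * R ^ (2 + ρ) with htdef
  have hRpow0 : 0 < R ^ (2 + ρ) := Real.rpow_pos_of_pos hR0 _
  have ht0 : 0 ≤ t := by rw [htdef]; positivity
  -- the lingering part of the ball
  set S : Set (EuclideanSpace ℝ (Fin 3)) := {y | ∀ σ ∈ Icc 0 t,
    ‖ODE.evolutionMap (fun _ : ℝ => selfSimilarTransport γ 0 V') 0 (-σ) y‖ ≤ 2 * R} with hS
  have hSclosed : IsClosed S := by
    have hC := Loc.isClosed_backwardStaySet (γ := γ) hV' hK (2 * R)
    have hSe : S = (fun y : EuclideanSpace ℝ (Fin 3) => ((t, y) : ℝ × EuclideanSpace ℝ (Fin 3))) ⁻¹'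
        {p : ℝ × EuclideanSpace ℝ (Fin 3) | 0 ≤ p.1 ∧ ∀ σ ∈ Icc 0 p.1,
          ‖ODE.evolutionMap (fun _ : ℝ => selfSimilarTransport γ 0 V') 0 (-σ) p.2‖ ≤ 2 * R} := by
      ext y
      simp only [hS, mem_setOf_eq, mem_preimage]
      exact ⟨fun h => ⟨ht0, h⟩, fun h => h.2⟩
    rw [hSe]
    exact hC.preimage (continuous_const.prodMk continuous_id)
  have hDm : MeasurableSet (ball x₀ r ∩ S) := measurableSet_ball.inter hSclosed.measurableSet
  -- the race
  have hrace := volume_linger_set_le_of_stretching hprof hstrain hbE hV' hK (by linarith : (1 : ℝ) ≤ 2 * R) hRbig hVU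
    hDm hωpos.le (fun y hy => hball hy.1) ht0 (fun y hy => hy.2)
  -- real form: `vol D ≤ e^{3γt} cC² CE (2R)^{1−ρ} / (ω² e^{2(1−s)t})`
  have hlampos : 0 < ω ^ 2 * Real.exp (2 * (1 - s) * t) := by positivity
  set B : ℝ := Real.exp (3 * (1 / (2 + ρ)) * t) * (cC ^ 2 * (CE * (2 * R) ^ (1 - ρ))) with hB
  have hB0 : 0 ≤ B := by rw [hB]; positivity
  have hvolD : (volume (ball x₀ r ∩ S)).toReal ≤ B / (ω ^ 2 * Real.exp (2 * (1 - s) * t)) := by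
    have h1 : volume (ball x₀ r ∩ S) ≤ ENNReal.ofReal B / ENNReal.ofReal (ω ^ 2 * Real.exp (2 * (1 - s) * t)) := by
      rw [ENNReal.le_div_iff_mul_le (Or.inl ((ENNReal.ofReal_pos.2 hlampos).ne'))
        (Or.inl ENNReal.ofReal_ne_top), mul_comm]
      exact hrace
    rw [← ENNReal.ofReal_div_of_pos hlampos] at h1
    exact ENNReal.toReal_le_of_le_ofReal (div_nonneg hB0 hlampos.le) h1
  -- arithmetic: `B / (ω² e^{2(1−s)t}) = (cC² CE (2R)^{1−ρ} / ω²) e^{−δ t} ≤ A R e^{−δt} ≤ 2A/(δ c′ R) ≤ v/2`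
  have hexp_split : Real.exp (3 * (1 / (2 + ρ)) * t) / Real.exp (2 * (1 - s) * t) = Real.exp (-(δ * t)) := by
    rw [← Real.exp_sub, hδ, hγ]; ring_nf
  have h2R : (2 * R) ^ (1 - ρ) ≤ 2 * R := by
    calc (2 * R) ^ (1 - ρ) ≤ (2 * R) ^ (1 : ℝ) :=
          Real.rpow_le_rpow_of_exponent_le (by linarith) (by linarith)
      _ = 2 * R := Real.rpow_one _
  have hRsq : R ^ (2 : ℝ) ≤ R ^ (2 + ρ) := Real.rpow_le_rpow_of_exponent_le hR1 (by linarith)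
  have hRsq' : R * R ≤ R ^ (2 + ρ) := by
    have : R ^ (2 : ℝ) = R * R := by rw [Real.rpow_two, sq]
    rw [← this]; exact hRsq
  have hexp_ge : δ * c' * (R * R) ≤ Real.exp (δ * t) := by
    calc δ * c' * (R * R) ≤ δ * c' * R ^ (2 + ρ) := mul_le_mul_of_nonneg_left hRsq' (by positivity)
      _ = δ * t := by rw [htdef]; ring
      _ ≤ δ * t + 1 := by linarith
      _ ≤ Real.exp (δ * t) := Real.add_one_le_exp _
  have hfinal : B / (ω ^ 2 * Real.exp (2 * (1 - s) * t)) ≤ v / 2 := by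
    have hE : 0 < Real.exp (δ * t) := Real.exp_pos _
    have hkey : B / (ω ^ 2 * Real.exp (2 * (1 - s) * t)) =
        cC ^ 2 * CE * (2 * R) ^ (1 - ρ) / ω ^ 2 * Real.exp (-(δ * t)) := by
      rw [← hexp_split, hB]
      field_simp
    rw [hkey, Real.exp_neg]
    -- `cC² CE (2R)^{1−ρ}/ω² · e^{−δt} ≤ A R / (δ c′ R²) = A/(δ c′ R) ≤ v/4 < v/2`
    have h1 : cC ^ 2 * CE * (2 * R) ^ (1 - ρ) / ω ^ 2 ≤ A * R := by
      rw [hA, div_mul_eq_mul_div]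
      refine div_le_div_of_nonneg_right ?_ (by positivity)
      calc cC ^ 2 * CE * (2 * R) ^ (1 - ρ) ≤ cC ^ 2 * CE * (2 * R) :=
            mul_le_mul_of_nonneg_left h2R (by positivity)
        _ = cC ^ 2 * CE * 2 * R := by ring
    have h2 : A * R * (Real.exp (δ * t))⁻¹ ≤ A * R * (δ * c' * (R * R))⁻¹ := by
      refine mul_le_mul_of_nonneg_left ?_ (by positivity)
      exact inv_anti₀ (by positivity) hexp_ge
    have h3 : A * R * (δ * c' * (R * R))⁻¹ = A / (δ * c' * R) := by
      field_simp
    have h4 : A / (δ * c' * R) ≤ v / 4 := by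
      rw [div_le_iff₀ (by positivity)]
      have := (div_lt_iff₀ (by positivity : (0 : ℝ) < δ * c' * v)).1 hRA
      nlinarith [this, hvpos]
    calc cC ^ 2 * CE * (2 * R) ^ (1 - ρ) / ω ^ 2 * (Real.exp (δ * t))⁻¹
        ≤ A * R * (Real.exp (δ * t))⁻¹ := mul_le_mul_of_nonneg_right h1 (by positivity)
      _ ≤ A * R * (δ * c' * (R * R))⁻¹ := h2
      _ = A / (δ * c' * R) := h3
      _ ≤ v / 4 := h4
      _ ≤ v / 2 := by linarith
  exact hvolD.trans hfinal

end NeedleClock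

/-! ## Member level -/

namespace NeedleRace

variable {V : EuclideanSpace ℝ (Fin 3) → EuclideanSpace ℝ (Fin 3)}

/-- **THE ENVELOPE-FREE STRAIN CLOCK AT MEMBER LEVEL.**  An exactly self-similar member of the window class
(`0 < ρ ≤ ½`, crux hypotheses verbatim) whose `C²` velocity profile has stretching rate
`⟪DV(z) v, v⟫ ≤ s‖v‖²` for all `z, v` with `s < (1+2ρ)/(2(2+ρ))` (so that vorticity growth `e^{2(1−s)t}` along lingering
orbits beats the Liouville volume factor `e^{3t/(2+ρ)}`) is trivial — the class's own enstrophy budget replaces the vorticity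
envelope of `selfSimilar_ae_eq_zero_of_strainClockC2`. [cite: ConstantinIgnatovaVicol2026Putative, §3.5] -/
theorem selfSimilar_ae_eq_zero_of_strongStrainClockC2 {ρ : ℝ} (hρ : 0 < ρ) (hρ1 : ρ ≤ 1 / 2)
    {u : ℝ → EuclideanSpace ℝ (Fin 3) → EuclideanSpace ℝ (Fin 3)} {p : ℝ → EuclideanSpace ℝ (Fin 3) → ℝ}
    {H : ℝ → EuclideanSpace ℝ (Fin 3) → EuclideanSpace ℝ (Fin 3) →L[ℝ] EuclideanSpace ℝ (Fin 3)} {c : ℝ≥0}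
    (hsw : IsSuitableWeakSolutionOn (slab (EuclideanSpace ℝ (Fin 3)) (Iio 0) isOpen_Iio) 0 0 u p)
    (hH : HasWeakSpatialGradientOn (slab (EuclideanSpace ℝ (Fin 3)) (Iio 0) isOpen_Iio) u H)
    (hgauge : ∀ a : ℝ, 0 < a →
      ENNReal.ofReal (a ^ (2 * ρ)) * cknA a (0 : ℝ × EuclideanSpace ℝ (Fin 3)) u +
          ENNReal.ofReal (a ^ ρ) * cknE a (0 : ℝ × EuclideanSpace ℝ (Fin 3)) H +
        ENNReal.ofReal (a ^ (2 * ρ)) * cknD a (0 : ℝ × EuclideanSpace ℝ (Fin 3)) p ≤ (c : ℝ≥0∞))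
    {P : EuclideanSpace ℝ (Fin 3) → ℝ}
    (hu : ∀ τ : ℝ, τ < 0 → u τ = selfSimilarCollapse (1 / (2 + ρ)) 0 V τ)
    (hp : ∀ τ : ℝ, τ < 0 → p τ = selfSimilarCollapsePressure (1 / (2 + ρ)) 0 P τ)
    (hV : ContDiff ℝ 2 V) {s : ℝ} (hs : s < (1 + 2 * ρ) / (2 * (2 + ρ)))
    (hstrain : ∀ z v : EuclideanSpace ℝ (Fin 3), ⟪fderiv ℝ V z v, v⟫ ≤ s * ‖v‖ ^ 2) :
    uncurry u =ᵐ[volume.restrict (Iio (0 : ℝ) ×ˢ (univ : Set (EuclideanSpace ℝ (Fin 3))))] 0 := by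
  have hρ1' : ρ < 1 := by linarith
  have h2ρ : (0 : ℝ) < 2 + ρ := by linarith
  -- the classical profile equation for some `C¹` pressure
  have hu' : ∀ τ : ℝ, τ < 0 → u τ = fun x => selfSimilarCollapse (1 / (2 + ρ)) 0 V τ (x - 0) := by
    intro τ hτ; rw [hu τ hτ]; funext x; rw [sub_zero]
  have hp' : ∀ τ : ℝ, τ < 0 → p τ = fun x => selfSimilarCollapsePressure (1 / (2 + ρ)) 0 P τ (x - 0) := by
    intro τ hτ; rw [hp τ hτ]; funext x; rw [sub_zero]
  obtain ⟨P', hprof⟩ := Past.exists_isSelfSimilarEulerProfile hρ le_rfl le_rfl hsw.distributional hu' hp' hV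
  -- the class enstrophy budget on closed balls
  obtain ⟨-, hE'⟩ := NeedleThinCore.selfSimilar_needle_inputs hρ hρ1' hsw hH hgauge hu hp (hV.of_le one_le_two)
  have hE0 : 0 ≤ (1 - ρ) / (2 + ρ) * (c : ℝ) := by
    have : 0 ≤ 1 - ρ := by linarith
    positivity
  have hbE : ∀ L : ℝ, 1 ≤ L →
      ∫⁻ z in closedBall (0 : EuclideanSpace ℝ (Fin 3)) L, ‖fderiv ℝ V z‖ₑ ^ 2 ≤
        ENNReal.ofReal ((1 - ρ) / (2 + ρ) * (c : ℝ) * L ^ (1 - ρ)) :=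
    fun L hL => lintegral_fderiv_sq_closedBall_le hρ1' hE0 hE' hL
  -- the race condition `3/(2+ρ) < 2(1−s)` from `s < (1+2ρ)/(2(2+ρ))`
  have hrace : 3 / (2 + ρ) < 2 * (1 - s) := by
    have h1 : s * (2 * (2 + ρ)) < 1 + 2 * ρ := (lt_div_iff₀ (by positivity)).1 hs
    rw [div_lt_iff₀ h2ρ]
    nlinarith
  exact selfSimilar_ae_eq_zero_of_subcriticalClockC2 hρ hρ1 hsw hH hgauge hu hp hV
    (NeedleClock.powerClock_of_stretching_lt hprof hρ.le hrace hstrain hE0 hbE)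

end NeedleRace

end Summit.NavierStokesRegularity.NavierStokesRegularity.Theorems.PowerGaugeEulerLiouville

end
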